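import Mathlib

/-!
# MatrixMultiplication / NilpotentLieHosts — `NilpotentThresholdDesigns`, recentring stub

Route `NilpotentLieHosts`, crux `NilpotentThresholdDesigns` (stmt-MatrixMultiplication-7720), line
`registered` (`Cruxes/NilpotentThresholdDesigns/Lines/birth.lean`, recentred identity certificates),
stub `stub_recenter`.

TWO-SIDED TRANSLATION STABILITY OF THE `(j − i)`-WEIGHTED DEGREE.  Give the matrix-entry variable
`X (i, j)` of `MvPolynomial (Fin d × Fin d) ℂ` the weight `j ∸ i` (truncated subtraction, so entries on
or below the diagonal weigh `0`).  For upper unitriangular `g, h ∈ SL(d, ℤ)` and any polynomial `p`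
there is a polynomial `p'` of no larger weighted degree with `p'(M) = p(g⁻¹ M h)` for every
`M ∈ SL(d, ℤ)`: the space `Pol^wt_{≤ s}` is a `U_d(ℤ) × U_d(ℤ)`-bimodule (the translation-closure of
Blasiak–Cohn–Grochow–Pratt–Umans 2024, Thm 2.2 / Rem 2.4, in the unipotent host).

Proof.  `p' := bind₁ σ p` with the linear substitution
`σ (k, l) := Σ_{i, j} (g⁻¹)_{k i} h_{j l} · X (i, j)`.  Evaluation is `eval M (bind₁ σ p) =
eval (eval M ∘ σ) p` and `eval M (σ (k, l)) = (g⁻¹ M h)_{k l}` (matrix multiplication).  For the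
degree, `g⁻¹` is again upper triangular (`Matrix.blockTriangular_inv_of_blockTriangular`, `det g = 1`),
so the coefficient of `X (i, j)` in `σ (k, l)` vanishes unless `k ≤ i` and `j ≤ l`, whence
`j ∸ i ≤ l ∸ k`; and `bind₁` by a weight-non-increasing substitution does not increase the weighted
degree (sub-additivity of `weightedTotalDegree` under sums and sub-multiplicativity under products,
imported from `AddMonoidAlgebra.supDegree_*`).

The general weighted-degree bookkeeping (`wdeg_*`) is kept here as small reusable lemmas; Mathlib
(as of this toolchain) only has the unweighted `totalDegree_*` versions.
-/

-- the tree's namespace `Summit.MatrixMultiplication.MatrixMultiplication.…` repeats a component by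
-- design
set_option linter.dupNamespace false

noncomputable section

open MvPolynomial

open scoped BigOperators Matrix

namespace Summit.MatrixMultiplication.MatrixMultiplication.Theorems.NilpotentThresholdDesigns

section WeightedDegree

variable {σ : Type*} {R : Type*} [CommSemiring R] (w : σ → ℕ)

/-- `wdeg (Σ_{i ∈ s} F i) ≤ sup_{i ∈ s} wdeg (F i)`. [folklore] -/
theorem wdeg_sum_le {ι : Type*} (s : Finset ι) (F : ι → MvPolynomial σ R) :
    weightedTotalDegree w (∑ i ∈ s, F i) ≤ s.sup fun i => weightedTotalDegree w (F i) :=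
  AddMonoidAlgebra.supDegree_sum_le (D := ⇑(Finsupp.weight w))

/-- `wdeg (p * q) ≤ wdeg p + wdeg q`. [folklore] -/
theorem wdeg_mul_le (p q : MvPolynomial σ R) :
    weightedTotalDegree w (p * q) ≤ weightedTotalDegree w p + weightedTotalDegree w q :=
  AddMonoidAlgebra.supDegree_mul_le (D := ⇑(Finsupp.weight w)) (map_add _)

/-- `wdeg (Π_{i ∈ s} F i) ≤ Σ_{i ∈ s} wdeg (F i)`. [folklore] -/
theorem wdeg_prod_le {ι : Type*} (s : Finset ι) (F : ι → MvPolynomial σ R) :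
    weightedTotalDegree w (∏ i ∈ s, F i) ≤ ∑ i ∈ s, weightedTotalDegree w (F i) := by
  classical
  exact AddMonoidAlgebra.supDegree_prod_le (D := ⇑(Finsupp.weight w)) (map_zero _) (map_add _)

/-- `wdeg (p ^ n) ≤ n · wdeg p`. [folklore] -/
theorem wdeg_pow_le (p : MvPolynomial σ R) (n : ℕ) :
    weightedTotalDegree w (p ^ n) ≤ n * weightedTotalDegree w p := by
  rw [Finset.pow_eq_prod_const, ← Nat.nsmul_eq_mul, Finset.nsmul_eq_sum_const]
  exact wdeg_prod_le w _ _

/-- `wdeg (monomial s a) ≤ n` as soon as `weight s ≤ n` (or `a = 0`). [folklore] -/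
theorem wdeg_monomial_le_of {s : σ →₀ ℕ} {a : R} {n : ℕ} (h : a ≠ 0 → Finsupp.weight w s ≤ n) :
    weightedTotalDegree w (monomial s a) ≤ n := by
  classical
  refine (AddMonoidAlgebra.supDegree_single (D := ⇑(Finsupp.weight w)) s a).trans_le ?_
  split_ifs with ha
  exacts [bot_le, h ha]

/-- Constants have weighted degree `0`. [folklore] -/
theorem wdeg_C (a : R) : weightedTotalDegree w (C a : MvPolynomial σ R) = 0 :=
  Nat.eq_zero_of_le_zero (wdeg_monomial_le_of w fun _ => (map_zero (Finsupp.weight w)).le)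

/-- **Substitution by weight-non-increasing polynomials does not increase the weighted degree**:
if `wdeg (f v) ≤ w v` for every variable `v`, then `wdeg (bind₁ f p) ≤ wdeg p`. [folklore] -/
theorem wdeg_bind₁_le {τ : Type*} (w' : τ → ℕ) (f : σ → MvPolynomial τ R)
    (hf : ∀ v, weightedTotalDegree w' (f v) ≤ w v) (p : MvPolynomial σ R) :
    weightedTotalDegree w' (bind₁ f p) ≤ weightedTotalDegree w p := by
  classical
  conv_lhs => rw [p.as_sum]
  rw [map_sum]
  refine (wdeg_sum_le w' _ _).trans (Finset.sup_le fun m hm => ?_)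
  rw [bind₁_monomial]
  refine (wdeg_mul_le w' _ _).trans ?_
  rw [wdeg_C, zero_add]
  refine (wdeg_prod_le w' _ _).trans (le_trans ?_ (le_weightedTotalDegree w hm))
  rw [Finsupp.weight_apply, Finsupp.sum]
  refine Finset.sum_le_sum fun v _ => (wdeg_pow_le w' _ _).trans ?_
  rw [smul_eq_mul]
  exact Nat.mul_le_mul_left _ (hf v)

end WeightedDegree

/-- **STUB `stub_recenter` — two-sided translation stability of the `(j − i)`-weighted degree**
(`Pol^wt_{≤ s}` is a `U_d × U_d`-bimodule).  For upper unitriangular `g, h ∈ SL(d, ℤ)` and any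
`p ∈ ℂ[X_{ij}]` there is `p'` with `wdeg p' ≤ wdeg p` (weight of `X_{ij}` = `j ∸ i`) and
`p'(M) = p(g⁻¹ M h)` for all `M ∈ SL(d, ℤ)`.  Construction: `p' := bind₁ σ p` with
`σ (k, l) = Σ_{i j} (g⁻¹)_{k i} h_{j l} X (i, j)`; `g⁻¹` is upper triangular, so only `k ≤ i`, `j ≤ l`
contribute and `j ∸ i ≤ l ∸ k`. [cite: BlasiakCohnGrochowPrattUmans2024, Thm 2.2 / Rem 2.4] -/
theorem stub_recenter :
    ∀ (d : ℕ) (g h : Matrix.SpecialLinearGroup (Fin d) ℤ),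
    (∀ i j : Fin d, j ≤ i → (g : Matrix (Fin d) (Fin d) ℤ) i j = if i = j then 1 else 0) →
    (∀ i j : Fin d, j ≤ i → (h : Matrix (Fin d) (Fin d) ℤ) i j = if i = j then 1 else 0) →
    ∀ p : MvPolynomial (Fin d × Fin d) ℂ, ∃ p' : MvPolynomial (Fin d × Fin d) ℂ,
      MvPolynomial.weightedTotalDegree (fun ij : Fin d × Fin d => (ij.2 : ℕ) - ij.1) p' ≤
          MvPolynomial.weightedTotalDegree (fun ij : Fin d × Fin d => (ij.2 : ℕ) - ij.1) p ∧
      ∀ M : Matrix.SpecialLinearGroup (Fin d) ℤ,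
        MvPolynomial.eval (fun ij : Fin d × Fin d => ((M : Matrix (Fin d) (Fin d) ℤ) ij.1 ij.2 : ℂ)) p' =
          MvPolynomial.eval (fun ij : Fin d × Fin d =>
            (((g⁻¹ * M * h : Matrix.SpecialLinearGroup (Fin d) ℤ) : Matrix (Fin d) (Fin d) ℤ) ij.1 ij.2 : ℂ)) p := by
  intro d g h hg hh p
  -- the linear substitution `X (k, l) ↦ Σ_{i j} (g⁻¹)_{k i} h_{j l} X (i, j)`
  let f : Fin d × Fin d → MvPolynomial (Fin d × Fin d) ℂ := fun kl =>
    ∑ i : Fin d, ∑ j : Fin d,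
      C ((((g⁻¹ : Matrix.SpecialLinearGroup (Fin d) ℤ) : Matrix (Fin d) (Fin d) ℤ) kl.1 i *
          (h : Matrix (Fin d) (Fin d) ℤ) j kl.2 : ℤ) : ℂ) * X (i, j)
  refine ⟨bind₁ f p, ?_, ?_⟩
  · -- degree: `g⁻¹` and `h` are upper triangular
    have hgt : (g : Matrix (Fin d) (Fin d) ℤ).BlockTriangular id :=
      fun i j (hij : j < i) => by rw [hg i j hij.le, if_neg hij.ne']
    have hdet : IsUnit (g : Matrix (Fin d) (Fin d) ℤ).det := by
      rw [Matrix.SpecialLinearGroup.det_coe]; exact isUnit_one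
    letI : Invertible (g : Matrix (Fin d) (Fin d) ℤ) := Matrix.invertibleOfIsUnitDet _ hdet
    have hGt : ((g⁻¹ : Matrix.SpecialLinearGroup (Fin d) ℤ) : Matrix (Fin d) (Fin d) ℤ).BlockTriangular
        id := by
      have e : ((g⁻¹ : Matrix.SpecialLinearGroup (Fin d) ℤ) : Matrix (Fin d) (Fin d) ℤ) =
          (g : Matrix (Fin d) (Fin d) ℤ)⁻¹ := by
        rw [Matrix.SpecialLinearGroup.coe_inv, Matrix.inv_def, Matrix.SpecialLinearGroup.det_coe,
          Ring.inverse_one, one_smul]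
      rw [e]
      exact Matrix.blockTriangular_inv_of_blockTriangular hgt
    have hHt : ∀ ⦃j l : Fin d⦄, l < j → (h : Matrix (Fin d) (Fin d) ℤ) j l = 0 :=
      fun j l hlj => by rw [hh j l hlj.le, if_neg hlj.ne']
    have hf : ∀ kl : Fin d × Fin d,
        weightedTotalDegree (fun ij : Fin d × Fin d => (ij.2 : ℕ) - ij.1) (f kl) ≤ (kl.2 : ℕ) - kl.1 := by
      rintro ⟨k, l⟩
      simp only [f]
      refine (wdeg_sum_le _ _ _).trans (Finset.sup_le fun i _ => ?_)
      refine (wdeg_sum_le _ _ _).trans (Finset.sup_le fun j _ => ?_)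
      rw [C_mul_X_eq_monomial]
      refine wdeg_monomial_le_of _ fun hc => ?_
      rw [Finsupp.weight_single, one_smul]
      have hc' : ((g⁻¹ : Matrix.SpecialLinearGroup (Fin d) ℤ) : Matrix (Fin d) (Fin d) ℤ) k i *
          (h : Matrix (Fin d) (Fin d) ℤ) j l ≠ 0 := fun h0 => hc (by rw [h0, Int.cast_zero])
      obtain ⟨hGki, hHjl⟩ := mul_ne_zero_iff.mp hc'
      have hki : k ≤ i := not_lt.mp fun hlt => hGki (hGt hlt)
      have hjl : j ≤ l := not_lt.mp fun hlt => hHjl (hHt hlt)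
      rw [Fin.le_def] at hki hjl
      show (j : ℕ) - i ≤ (l : ℕ) - k
      omega
    exact wdeg_bind₁_le _ _ f hf p
  · -- evaluation: `eval M (bind₁ f p) = eval (eval M ∘ f) p` and `eval M (f (k, l)) = (g⁻¹ M h)_{k l}`
    intro M
    have key : ∀ (x : Fin d × Fin d → ℂ) (q : MvPolynomial (Fin d × Fin d) ℂ),
        MvPolynomial.eval x (bind₁ f q) =
          MvPolynomial.eval (fun v => MvPolynomial.eval x (f v)) q :=
      fun x q => eval₂Hom_bind₁ _ _ _ _
    have hfun : (fun v : Fin d × Fin d =>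
        MvPolynomial.eval (fun ij : Fin d × Fin d => ((M : Matrix (Fin d) (Fin d) ℤ) ij.1 ij.2 : ℂ))
          (f v)) =
        fun ij : Fin d × Fin d =>
          (((g⁻¹ * M * h : Matrix.SpecialLinearGroup (Fin d) ℤ) : Matrix (Fin d) (Fin d) ℤ)
            ij.1 ij.2 : ℂ) := by
      funext ⟨k, l⟩
      simp only [f, map_sum, map_mul, eval_C, eval_X, Matrix.SpecialLinearGroup.coe_mul,
        Matrix.mul_apply, Int.cast_sum, Int.cast_mul, Finset.sum_mul]
      rw [Finset.sum_comm]
      exact Finset.sum_congr rfl fun _ _ => Finset.sum_congr rfl fun _ _ => by ring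
    rw [key, hfun]

end Summit.MatrixMultiplication.MatrixMultiplication.Theorems.NilpotentThresholdDesigns

end
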